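import Mathlib

/-!
# Why the Marica–Schönheim pencil can be singular in positive characteristic: families with uniform column counts

Helper file for crux `stmt-CriticalPhenomena-4575` (`NoHeavyLowerTail`, route `PercNearOneGluingNoHeavy`),
new-inequality factory seat `prim-ineq-gen-3` (gen 24).  Everything here is PROVED; no definitions.

Companion of `PercNearOneGluingNoHeavyLowerTailOrderedDifferencesFano` (the Fano plane over `ZMod 7`).  The mechanism behind
that counterexample is isolated here: if every non-empty difference `E ∈ 𝒜 \\ 𝒜` lies in exactly `u` members and is disjoint
from exactly `v` members (a regularity enjoyed by the lines of every projective plane and by every symmetric design whose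
differences `A \ B` determine `A`), then the SUM of the pencil rows `A ↦ (E ↦ [E ⊆ A] + t [E ∩ A = ∅])` is the vector
`(#𝒜 · (1 + t); u + t v, …, u + t v)`.  Over a field of characteristic `p ∣ #𝒜` it vanishes at `t = -u/v`, so the pencil rows
are linearly dependent there — and `t = -u/v` is `± 1` only when `u ≡ ∓ v (mod p)`:

* `sum_pencil_rows_of_uniform` — the column sums under the regularity hypothesis;
* `not_linearIndependent_pencil_of_uniform` — dependence of the pencil rows when `(#𝒜 : K) = 0` and `u + t v = 0`.

Instances (memo FINDINGS-gen24.md): lines of `PG(2,q)` (`u = 1`, `v = q`, `#𝒜 = q² + q + 1`; bad prime `p ∣ q² + q + 1`,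
`p ≠ 3`, `t = -1/q`), the `(15,7,3)` design over `ZMod 5` (`t = 2`), the Fano plane over `ZMod 7` (`t = 3`).
(prim-ineq-gen-3 gen 24, 2026-08-24.)
-/

namespace Summit.CriticalPhenomena.PercolationContinuityZ3.Theorems

namespace OrderedDifferences

open Finset
open scoped FinsetFamily

variable {α : Type*} [DecidableEq α] {K : Type*} [Field K]

/-- **Column sums of the pencil under uniform counts.**  If every non-empty `E ∈ 𝒜 \\ 𝒜` is contained in exactly `u` members
of `𝒜` and disjoint from exactly `v` members, then for every `E ∈ 𝒜 \\ 𝒜` the sum over `A ∈ 𝒜` of the pencil entries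
`[E ⊆ A] + t [E ∩ A = ∅]` equals `#𝒜 · (1 + t)` if `E = ∅` and `u + t v` otherwise. -/
theorem sum_pencil_rows_of_uniform (𝒜 : Finset (Finset α)) (u v : ℕ) (t : K)
    (hu : ∀ E ∈ 𝒜 \\ 𝒜, E ≠ ∅ → #(𝒜.filter fun A => E ⊆ A) = u)
    (hv : ∀ E ∈ 𝒜 \\ 𝒜, E ≠ ∅ → #(𝒜.filter fun A => Disjoint E A) = v)
    (E : Finset α) (hE : E ∈ 𝒜 \\ 𝒜) :
    ∑ A ∈ 𝒜, ((if E ⊆ A then (1 : K) else 0) + t * (if Disjoint E A then (1 : K) else 0)) =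
      if E = ∅ then (#𝒜 : K) * (1 + t) else (u : K) + t * v := by
  rw [sum_add_distrib, ← mul_sum, sum_boole, sum_boole]
  by_cases h0 : E = ∅
  · subst h0
    have h1 : 𝒜.filter (fun A => (∅ : Finset α) ⊆ A) = 𝒜 := filter_true_of_mem fun A _ => empty_subset A
    have h2 : 𝒜.filter (fun A => Disjoint (∅ : Finset α) A) = 𝒜 := filter_true_of_mem fun A _ => disjoint_empty_left A
    rw [h1, h2, if_pos rfl]
    ring
  · rw [hu E hE h0, hv E hE h0, if_neg h0]

/-- **Uniform counts make the pencil singular in characteristic `p ∣ #𝒜`.**  Under the regularity hypothesis of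
`sum_pencil_rows_of_uniform`, if `(#𝒜 : K) = 0` and `u + t v = 0` in the field `K`, then the pencil rows
`A ↦ (E ↦ [E ⊆ A] + t [E ∩ A = ∅])` over `𝒜 \\ 𝒜` are linearly dependent over `K` (their sum vanishes; `𝒜` is non-empty).
Nothing forces `t * t = 1` here: for the lines of `PG(2,q)` one gets `t = -1/q` over `ZMod p`, `p ∣ q² + q + 1`. -/
theorem not_linearIndependent_pencil_of_uniform (𝒜 : Finset (Finset α)) (h𝒜 : 𝒜.Nonempty) (u v : ℕ) (t : K)
    (hu : ∀ E ∈ 𝒜 \\ 𝒜, E ≠ ∅ → #(𝒜.filter fun A => E ⊆ A) = u)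
    (hv : ∀ E ∈ 𝒜 \\ 𝒜, E ≠ ∅ → #(𝒜.filter fun A => Disjoint E A) = v)
    (hm : (#𝒜 : K) = 0) (ht : (u : K) + t * v = 0) :
    ¬ LinearIndependent K (fun A : 𝒜 => fun E : (𝒜 \\ 𝒜 : Finset (Finset α)) =>
      (if (E : Finset α) ⊆ (A : Finset α) then (1 : K) else 0) +
        t * (if Disjoint (E : Finset α) (A : Finset α) then (1 : K) else 0)) := by
  classical
  rw [Fintype.not_linearIndependent_iff]
  obtain ⟨A₀, hA₀⟩ := h𝒜
  refine ⟨fun _ => 1, ?_, ⟨⟨A₀, hA₀⟩, one_ne_zero⟩⟩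
  funext E
  obtain ⟨E, hE⟩ := E
  simp only [Finset.sum_apply, Pi.smul_apply, smul_eq_mul, one_mul, Pi.zero_apply]
  have e : (∑ A : 𝒜, ((if E ⊆ (A : Finset α) then (1 : K) else 0) +
      t * (if Disjoint E (A : Finset α) then (1 : K) else 0))) =
      ∑ A ∈ 𝒜, ((if E ⊆ A then (1 : K) else 0) + t * (if Disjoint E A then (1 : K) else 0)) :=
    Finset.sum_coe_sort _ (fun A => (if E ⊆ A then (1 : K) else 0) + t * (if Disjoint E A then (1 : K) else 0))
  rw [e, sum_pencil_rows_of_uniform 𝒜 u v t hu hv E hE]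
  split_ifs
  · rw [hm, zero_mul]
  · exact ht

end OrderedDifferences

end Summit.CriticalPhenomena.PercolationContinuityZ3.Theorems
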